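import Mathlib
import Summits.ValiantsHypothesis.ValiantsHypothesis.Theorems.NewtonTauWeak.Negative.Zonogon
import Summits.ValiantsHypothesis.ValiantsHypothesis.Theorems.NewtonUnitEquationsNewtonTauWeakSeparatedRank
import Summits.ValiantsHypothesis.ValiantsHypothesis.Theorems.NewtonUnitEquationsNewtonTauWeakVdpDefs
import Summits.ValiantsHypothesis.ValiantsHypothesis.Theorems.NewtonUnitEquationsNewtonTauWeakStubVertexCharts
import Summits.ValiantsHypothesis.ValiantsHypothesis.Theorems.NewtonUnitEquationsNewtonTauWeakStubChartPairCount
import Summits.ValiantsHypothesis.ValiantsHypothesis.Theorems.NewtonUnitEquationsNewtonTauWeakStubProductVertices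

/-!
# `NewtonUnitEquationsNewtonTauWeakHexagonDelta` — Δ-Wronskian rung, HexagonDelta

Rung toward `stub_binomialNewtonTauCommon` (crux `NewtonTauWeak`, stmt-ValiantsHypothesis-5904), line
`binomial-normal-form`, lead c3: the GLOBAL Δ-WRONSKIAN argument for sums of three hexagon products
`A(x)·B(y)·C(xy)` (exponent lists on the three lines through `(1,0)`, `(0,1)`, `(1,1)`; any degrees).

This file: the routine calculus of `Δ` from its coefficient law — additivity (the finite-sum
rule is `HexagonTrichotomy.delta_sum'` of the trichotomy file), support, the LEIBNIZ RULE `Δ(pq) = Δp·q + p·Δq` (registered stub `hex_delta_mul`), `Δ D = 0` for diagonal `D`, and existence (registered stub `hex_exists_delta`).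

Conventions (spelled inline, no new definitions): `Δ` is ANY self-map of `ℂ[X,Y]` with
`coeff e (Δ p) = (e₀ - e₁) · coeff e p` (the Euler derivation `X∂_X - Y∂_Y`, which kills the diagonal
direction); "x-only" `P` means `∀ e ∈ P.support, e 1 = 0`, "y-only" `∀ e ∈ Q.support, e 0 = 0`, "diagonal"
`∀ e ∈ D.support, e 0 = e 1`; "separated of rank `R`" means `m = Σ_{r<R} P_r · Q_r` with `P_r` x-only and
`Q_r` y-only. [folklore]
-/

set_option linter.dupNamespace false

noncomputable section

namespace Summit.ValiantsHypothesis.ValiantsHypothesis.Theorems.NewtonUnitEquationsNewtonTauWeak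

open scoped BigOperators
open MvPolynomial
open Literature.Computability.AlgebraicComplexity (newtonVertexCount)
open Summit.ValiantsHypothesis.ValiantsHypothesis.Theorems.NewtonTauWeakVdp
open Summit.ValiantsHypothesis.ValiantsHypothesis.Theorems.NewtonTauWeak.Negative (vert)

/-- `hex_delta_add` (see file header). [folklore] -/
theorem hex_delta_add (Δ : MvPolynomial (Fin 2) ℂ → MvPolynomial (Fin 2) ℂ)
    (hΔ : ∀ p e, coeff e (Δ p) = (((e 0 : ℕ) : ℂ) - ((e 1 : ℕ) : ℂ)) * coeff e p)
    (p q : MvPolynomial (Fin 2) ℂ) : Δ (p + q) = Δ p + Δ q := by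
  ext e
  rw [hΔ, coeff_add, coeff_add, hΔ, hΔ]
  ring

/-- `hex_delta_sub` (see file header). [folklore] -/
theorem hex_delta_sub (Δ : MvPolynomial (Fin 2) ℂ → MvPolynomial (Fin 2) ℂ)
    (hΔ : ∀ p e, coeff e (Δ p) = (((e 0 : ℕ) : ℂ) - ((e 1 : ℕ) : ℂ)) * coeff e p)
    (p q : MvPolynomial (Fin 2) ℂ) : Δ (p - q) = Δ p - Δ q := by
  ext e
  rw [hΔ, coeff_sub, coeff_sub, hΔ, hΔ]
  ring

/-- `hex_delta_C_mul` (see file header). [folklore] -/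
theorem hex_delta_C_mul (Δ : MvPolynomial (Fin 2) ℂ → MvPolynomial (Fin 2) ℂ)
    (hΔ : ∀ p e, coeff e (Δ p) = (((e 0 : ℕ) : ℂ) - ((e 1 : ℕ) : ℂ)) * coeff e p)
    (c : ℂ) (p : MvPolynomial (Fin 2) ℂ) : Δ (C c * p) = C c * Δ p := by
  ext e
  rw [hΔ, coeff_C_mul, coeff_C_mul, hΔ]
  ring

-- NOTE: the finite-sum rule `Δ (∑ i ∈ s, f i) = ∑ i ∈ s, Δ (f i)` (skeleton name `hex_delta_sum`)
-- is already in the tree, with the identical statement and argument order `(Δ) (hΔ) {ι} (s) (f)`, as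
-- `HexagonTrichotomy.delta_sum'` in `…NewtonUnitEquationsNewtonTauWeakHexagonTrichotomy.lean`;
-- it is not restated here (the gate rejects duplicate statements).

/-- `hex_mem_support_delta` (see file header). [folklore] -/
theorem hex_mem_support_delta (Δ : MvPolynomial (Fin 2) ℂ → MvPolynomial (Fin 2) ℂ)
    (hΔ : ∀ p e, coeff e (Δ p) = (((e 0 : ℕ) : ℂ) - ((e 1 : ℕ) : ℂ)) * coeff e p)
    (p : MvPolynomial (Fin 2) ℂ) (e : Fin 2 →₀ ℕ) :
    e ∈ (Δ p).support ↔ e ∈ p.support ∧ e 0 ≠ e 1 := by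
  rw [mem_support_iff, mem_support_iff, hΔ, mul_ne_zero_iff, sub_ne_zero]
  constructor
  · rintro ⟨h1, h2⟩
    exact ⟨h2, fun h => h1 (by rw [h])⟩
  · rintro ⟨h1, h2⟩
    exact ⟨fun h => h2 (Nat.cast_injective h), h1⟩

/-- `hex_support_delta_subset` (see file header). [folklore] -/
theorem hex_support_delta_subset (Δ : MvPolynomial (Fin 2) ℂ → MvPolynomial (Fin 2) ℂ)
    (hΔ : ∀ p e, coeff e (Δ p) = (((e 0 : ℕ) : ℂ) - ((e 1 : ℕ) : ℂ)) * coeff e p)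
    (p : MvPolynomial (Fin 2) ℂ) : (Δ p).support ⊆ p.support := by
  intro e he
  exact ((hex_mem_support_delta Δ hΔ p e).1 he).1

/-- Leibniz rule. -/
theorem hex_delta_mul (Δ : MvPolynomial (Fin 2) ℂ → MvPolynomial (Fin 2) ℂ)
    (hΔ : ∀ p e, coeff e (Δ p) = (((e 0 : ℕ) : ℂ) - ((e 1 : ℕ) : ℂ)) * coeff e p)
    (p q : MvPolynomial (Fin 2) ℂ) : Δ (p * q) = Δ p * q + p * Δ q := by
  classical
  ext e
  rw [hΔ, coeff_add, coeff_mul, coeff_mul, coeff_mul, ← Finset.sum_add_distrib, Finset.mul_sum]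
  refine Finset.sum_congr rfl fun x hx => ?_
  rw [Finset.HasAntidiagonal.mem_antidiagonal] at hx
  rw [hΔ, hΔ, ← hx, Finsupp.add_apply, Finsupp.add_apply, Nat.cast_add, Nat.cast_add]
  ring

/-- `hex_delta_eq_zero_of_diag` (see file header). [folklore] -/
theorem hex_delta_eq_zero_of_diag (Δ : MvPolynomial (Fin 2) ℂ → MvPolynomial (Fin 2) ℂ)
    (hΔ : ∀ p e, coeff e (Δ p) = (((e 0 : ℕ) : ℂ) - ((e 1 : ℕ) : ℂ)) * coeff e p)
    (D : MvPolynomial (Fin 2) ℂ) (hD : ∀ e ∈ D.support, e 0 = e 1) : Δ D = 0 := by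
  ext e
  rw [hΔ, coeff_zero]
  by_cases he : e ∈ D.support
  · rw [hD e he, sub_self, zero_mul]
  · rw [notMem_support_iff.1 he, mul_zero]

/-- `hex_exists_delta` (see file header). [folklore] -/
theorem hex_exists_delta :
    ∃ Δ : MvPolynomial (Fin 2) ℂ → MvPolynomial (Fin 2) ℂ,
      ∀ p e, coeff e (Δ p) = (((e 0 : ℕ) : ℂ) - ((e 1 : ℕ) : ℂ)) * coeff e p := by
  classical
  refine ⟨fun p => ∑ e ∈ p.support,
    monomial e ((((e 0 : ℕ) : ℂ) - ((e 1 : ℕ) : ℂ)) * coeff e p), fun p e => ?_⟩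
  dsimp only
  rw [coeff_sum]
  simp only [coeff_monomial]
  rw [Finset.sum_ite_eq' p.support e]
  split_ifs with h
  · rfl
  · rw [notMem_support_iff] at h
    rw [h, mul_zero]


end Summit.ValiantsHypothesis.ValiantsHypothesis.Theorems.NewtonUnitEquationsNewtonTauWeak

end
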